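/-
Copyright: the b2b-balaban cell (near-miss cell 7), T⁴-continuum fan-out, lineage t4-ne7b-p1 (node U5c COUNT member).
Released under the licence of the surrounding project.
-/
import Mathlib

/-!
# Crowding analysis (crowding theorem, part 2): the cost side in sequence form

Summits-side support leaf of the T⁴-continuum cell (rung (B)+1 on a FINITE torus only; NOT infinite volume, NOT the
mass gap, NOT the Clay statement; NOT a proof of the spine estimate NE7b).  Lineage `t4-ne7b-p1`, node U5c, wall (GM),
located item G-ne7bp1g18-2 part (II).  Pure real analysis, [folklore]; nothing quoted, nothing printed asserted.

THE ESTIMATE.  Events per step `n : ℕ → ℕ` on a horizon `range (T+1)`, a contraction ratio `σ ∈ (0,1)` per step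
(`σ² = λ = 1∕L` in the chain), the DISCOUNTED CROWDING `Q n σ t = Σ_{s ≤ t} n_s σ^{2(t−s)}` (in the chain: an upper
bound for the zone-size driver `q_Z` of every merger at step `t`).  Then for every `p ≥ 0` and every `η > 0`, with the
explicit constant `crowdA p σ η`,

  `Σ_{t ≤ T} p · n_t · log (Q n σ t) ≤ 2η · Σ_{t ≤ T} n_t √n_t + crowdA p σ η · Σ_{t ≤ T} n_t`     (`cost_le`).

So the total zone-crowding cost of all mergers is paid by ANY superlinear per-step budget `n_t √n_t` with an
arbitrarily small coefficient plus a per-event constant — and parts 1∕1b (`CrowdingBudget`, `CrowdingRoots`) produce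
exactly such a budget out of `θ·Σ_births (d′+1) + ε·partnerAges`.  PROOF.  §1 `log Q ≤ c_σ + Σ_{s ≤ t} D s t`,
`D s t = (log n_s − (t−s)ℓ)₊`, `ℓ = −log σ` (a weighted sum is at most its total weight times the product of `max 1`
of the terms); §2 the matching `p N d ≤ η' N√N + (p³∕η'²) L² d` for `0 ≤ d ≤ L` (two cases on `η'√N` against `pL`),
used with `η' = η∕(j+1)²`; §3 for fixed `s` the error terms sum over `t` to `≤ (L∕ℓ + 1)⁵ L³`, and
`(L∕ℓ+1)⁵ L³ ≤ 8!·e·max(1,1∕ℓ)⁸ · n_s` (`(L+1)⁸ ≤ 8!·e^{L+1}`): the polylog is LINEAR in the event count, no absorption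
needed; §4 `Σ_{j<m} 1∕(j+1)² ≤ 2 − 1∕m` (§0), the double-sum swap, assembly.  §5 sanity.

HONEST DEPENDENCY (cell): continuum YM on T⁴ ⇐ BetaPertH ∧ nine spine estimates (0/9 proved); BetaPertH ⇐ (D1) ∧ (D4)
∧ CAP+tail.  This file changes none of it.
-/

namespace Summit.QuantumFields.BalabanUV.T4Continuum.Crowding

open Finset

noncomputable section

/-! ## §0 Elementary helpers -/

/-- a factor of a product of reals `≥ 1` is at most the product [folklore] -/
theorem single_le_prod_of_one_le {ι : Type*} [DecidableEq ι] (s : Finset ι) (f : ι → ℝ) (h1 : ∀ i ∈ s, 1 ≤ f i)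
    {i : ι} (hi : i ∈ s) : f i ≤ ∏ j ∈ s, f j := by
  rw [← mul_prod_erase s f hi]
  have hP : 1 ≤ ∏ j ∈ s.erase i, f j :=
    prod_induction f (fun x => 1 ≤ x) (fun a b ha hb => one_le_mul_of_one_le_of_one_le ha hb) le_rfl
      fun j hj => h1 j (mem_of_mem_erase hj)
  exact le_mul_of_one_le_right (le_trans zero_le_one (h1 i hi)) hP

/-- A weighted sum is at most its total weight times the product of `max 1` of the terms. [folklore] -/
theorem sum_mul_le_sum_mul_prod_max {ι : Type*} [DecidableEq ι] (s : Finset ι) (ω x : ι → ℝ)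
    (hω : ∀ i ∈ s, 0 ≤ ω i) : ∑ i ∈ s, ω i * x i ≤ (∑ i ∈ s, ω i) * ∏ i ∈ s, max 1 (x i) := by
  rw [sum_mul]
  refine sum_le_sum fun i hi => mul_le_mul_of_nonneg_left ?_ (hω i hi)
  exact (le_max_right 1 (x i)).trans
    (single_le_prod_of_one_le s (fun j => max 1 (x j)) (fun j _ => le_max_left _ _) hi)

/-- `Σ_{j < m} σ^j ≤ 1∕(1−σ)` for `σ ∈ [0,1)`. [folklore] -/
theorem geom_sum_le_inv {σ : ℝ} (h0 : 0 ≤ σ) (h1 : σ < 1) (m : ℕ) : ∑ j ∈ range m, σ ^ j ≤ 1 / (1 - σ) := by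
  have hne : σ ≠ 1 := ne_of_lt h1
  have hσ1 : 0 < 1 - σ := by linarith
  have hm : 0 ≤ σ ^ m := pow_nonneg h0 m
  rw [geom_sum_eq hne]
  have : (σ ^ m - 1) / (σ - 1) = (1 - σ ^ m) / (1 - σ) := by
    rw [← neg_div_neg_eq, neg_sub, neg_sub]
  rw [this]
  exact div_le_div_of_nonneg_right (by linarith) hσ1.le

/-- `Σ_{j < m} 1∕(j+1)² ≤ 2 − 1∕m` for `m ≥ 1` (telescoping `1∕(m+1)² ≤ 1∕m − 1∕(m+1)`). [folklore] -/
theorem sum_inv_sq_le {m : ℕ} (hm : 1 ≤ m) : ∑ j ∈ range m, 1 / ((j : ℝ) + 1) ^ 2 ≤ 2 - 1 / (m : ℝ) := by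
  induction m, hm using Nat.le_induction with
  | base => norm_num
  | succ m hm ih =>
      rw [sum_range_succ]
      have hm1 : (1 : ℝ) ≤ m := by exact_mod_cast hm
      have key : 1 / ((m : ℝ) + 1) ^ 2 + 1 / ((m : ℝ) + 1) ≤ 1 / (m : ℝ) := by
        rw [div_add_div _ _ (by positivity) (by positivity), div_le_div_iff₀ (by positivity) (by positivity)]
        nlinarith
      push_cast
      linarith

/-! ## §1 The discounted crowding and its logarithm -/

/-- THE DISCOUNTED CROWDING at step `t`: `Q n σ t = Σ_{s ≤ t} n_s · σ^{2(t−s)}`. [folklore] -/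
def Q (n : ℕ → ℕ) (σ : ℝ) (t : ℕ) : ℝ := ∑ s ∈ range (t + 1), (n s : ℝ) * σ ^ (2 * (t - s))

/-- THE DISCOUNTED LOG-COUNT `D n ℓ s t = (log n_s − (t − s)·ℓ)₊` (zero when `n_s ≤ 1`). [folklore] -/
def D (n : ℕ → ℕ) (ℓ : ℝ) (s t : ℕ) : ℝ := max 0 (Real.log (n s) - ((t - s : ℕ) : ℝ) * ℓ)

/-- `D ≥ 0` [folklore] -/
theorem D_nonneg (n : ℕ → ℕ) (ℓ : ℝ) (s t : ℕ) : 0 ≤ D n ℓ s t := le_max_left _ _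

/-- `D ≤ log n_s` when `ℓ ≥ 0` [folklore] -/
theorem D_le_log (n : ℕ → ℕ) {ℓ : ℝ} (hℓ : 0 ≤ ℓ) (s t : ℕ) : D n ℓ s t ≤ Real.log (n s) := by
  refine max_le (Real.log_natCast_nonneg (n s)) ?_
  have : 0 ≤ ((t - s : ℕ) : ℝ) * ℓ := by positivity
  linarith

/-- `n_t ≤ Q n σ t` (the own step's term). [folklore] -/
theorem self_le_Q (n : ℕ → ℕ) {σ : ℝ} (hσ : 0 ≤ σ) (t : ℕ) : (n t : ℝ) ≤ Q n σ t := by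
  unfold Q
  have h := single_le_sum (s := range (t + 1)) (f := fun s => (n s : ℝ) * σ ^ (2 * (t - s)))
    (fun s _ => by positivity) (mem_range.2 (Nat.lt_succ_self t))
  simpa using h

/-- `log (max 1 (k·σ^j)) ≤ (log k − j·ℓ)₊` with `ℓ = −log σ`. [folklore] -/
theorem log_max_one_le {σ : ℝ} (h0 : 0 < σ) (k j : ℕ) :
    Real.log (max 1 ((k : ℝ) * σ ^ j)) ≤ max 0 (Real.log k - (j : ℝ) * (-Real.log σ)) := by
  by_cases h : (k : ℝ) * σ ^ j ≤ 1
  · rw [max_eq_left h, Real.log_one]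
    exact le_max_left _ _
  · push Not at h
    rw [max_eq_right h.le]
    have hk : (k : ℝ) ≠ 0 := by
      intro hk
      rw [hk, zero_mul] at h
      exact absurd h (by norm_num)
    rw [Real.log_mul hk (pow_ne_zero _ h0.ne'), Real.log_pow]
    exact le_trans (le_of_eq (by ring)) (le_max_right _ _)

/-- **SCALE DECOMPOSITION.**  `log Q(t) ≤ −log(1−σ) + Σ_{s ≤ t} D n (−log σ) s t` whenever `n_t ≥ 1`. [folklore] -/
theorem log_Q_le {σ : ℝ} (h0 : 0 < σ) (h1 : σ < 1) (n : ℕ → ℕ) {t : ℕ} (ht : 1 ≤ n t) :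
    Real.log (Q n σ t) ≤ -Real.log (1 - σ) + ∑ s ∈ range (t + 1), D n (-Real.log σ) s t := by
  have hQ : Q n σ t = ∑ s ∈ range (t + 1), σ ^ (t - s) * ((n s : ℝ) * σ ^ (t - s)) := by
    unfold Q
    exact sum_congr rfl fun s _ => by ring
  have hW : ∑ s ∈ range (t + 1), σ ^ (t - s) ≤ 1 / (1 - σ) := by
    have hr := sum_range_reflect (fun j => σ ^ j) (t + 1)
    simp only [Nat.add_sub_cancel] at hr
    rw [hr]
    exact geom_sum_le_inv h0.le h1 (t + 1)
  set P := ∏ s ∈ range (t + 1), max 1 ((n s : ℝ) * σ ^ (t - s)) with hP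
  have hP1 : 1 ≤ P :=
    prod_induction _ (fun x => 1 ≤ x) (fun a b ha hb => one_le_mul_of_one_le_of_one_le ha hb) le_rfl
      fun j _ => le_max_left _ _
  have hQpos : 0 < Q n σ t := lt_of_lt_of_le (by exact_mod_cast ht) (self_le_Q n h0.le t)
  have hQle : Q n σ t ≤ 1 / (1 - σ) * P := by
    rw [hQ]
    refine (sum_mul_le_sum_mul_prod_max (range (t + 1)) (fun s => σ ^ (t - s))
      (fun s => (n s : ℝ) * σ ^ (t - s)) (fun s _ => by positivity)).trans ?_
    exact mul_le_mul_of_nonneg_right hW (le_trans zero_le_one hP1)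
  have hσ1 : 0 < 1 - σ := by linarith
  calc Real.log (Q n σ t) ≤ Real.log (1 / (1 - σ) * P) := Real.log_le_log hQpos hQle
    _ = -Real.log (1 - σ) + ∑ s ∈ range (t + 1), Real.log (max 1 ((n s : ℝ) * σ ^ (t - s))) := by
        rw [Real.log_mul (by positivity) (by positivity), one_div, Real.log_inv, hP,
          Real.log_prod (fun s _ => (lt_of_lt_of_le zero_lt_one (le_max_left _ _)).ne')]
    _ ≤ -Real.log (1 - σ) + ∑ s ∈ range (t + 1), D n (-Real.log σ) s t := by
        refine add_le_add le_rfl (sum_le_sum fun s _ => ?_)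
        exact log_max_one_le h0 (n s) (t - s)

/-! ## §2 The matching -/

/-- **MATCHING.**  For `0 ≤ d ≤ L`, `N ≥ 0`, `p ≥ 0`, `η > 0`: `p·N·d ≤ η·N·√N + (p³∕η²)·L²·d`
(if `pL ≤ η√N` the first term pays, else `N < (pL∕η)²` and the second does). [folklore] -/
theorem matching {p η N L d : ℝ} (hp : 0 ≤ p) (hη : 0 < η) (hN : 0 ≤ N) (hd0 : 0 ≤ d) (hdL : d ≤ L) :
    p * N * d ≤ η * N * Real.sqrt N + p ^ 3 / η ^ 2 * L ^ 2 * d := by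
  have hL : 0 ≤ L := hd0.trans hdL
  have h3 : 0 ≤ p ^ 3 / η ^ 2 * L ^ 2 * d := by positivity
  have h8 : 0 ≤ η * N * Real.sqrt N := by positivity
  by_cases hc : p * L ≤ η * Real.sqrt N
  · have h1 : p * N * d ≤ p * N * L := mul_le_mul_of_nonneg_left hdL (by positivity)
    have h2 : p * N * L ≤ η * N * Real.sqrt N := by nlinarith
    linarith
  · push Not at hc
    have hsq : Real.sqrt N * Real.sqrt N = N := Real.mul_self_sqrt hN
    have h4 : Real.sqrt N ≤ p * L / η := by
      rw [le_div_iff₀ hη]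
      linarith
    have h5 : N ≤ (p * L / η) ^ 2 := by
      calc N = Real.sqrt N ^ 2 := by rw [sq, hsq]
        _ ≤ (p * L / η) ^ 2 := pow_le_pow_left₀ (Real.sqrt_nonneg N) h4 2
    have h6 : p * N * d ≤ p * (p * L / η) ^ 2 * d :=
      mul_le_mul_of_nonneg_right (mul_le_mul_of_nonneg_left h5 hp) hd0
    have h7 : p * (p * L / η) ^ 2 * d = p ^ 3 / η ^ 2 * L ^ 2 * d := by
      field_simp
    linarith

/-! ## §3 The error terms: a polylog, linear in the event count -/

/-- For fixed `s`: `Σ_{t ∈ S, t ≥ s} (t−s+1)⁴ · L² · (L − (t−s)ℓ)₊ ≤ (L∕ℓ + 1)⁵ · L³` (only `t − s < L∕ℓ` contribute,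
at most `L∕ℓ + 1` of them, each `≤ (L∕ℓ+1)⁴ L³`). [folklore] -/
theorem error_sum_le {L ℓ : ℝ} (hL : 0 ≤ L) (hℓ : 0 < ℓ) (S : Finset ℕ) (s : ℕ) (hS : ∀ t ∈ S, s ≤ t) :
    ∑ t ∈ S, ((t - s : ℕ) + 1 : ℝ) ^ 4 * (L ^ 2 * max 0 (L - ((t - s : ℕ) : ℝ) * ℓ)) ≤
      (L / ℓ + 1) ^ 5 * L ^ 3 := by
  set B := (L / ℓ + 1) ^ 4 * L ^ 3 with hBdef
  have hB : 0 ≤ B := by positivity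
  have hterm : ∀ t ∈ S, ((t - s : ℕ) + 1 : ℝ) ^ 4 * (L ^ 2 * max 0 (L - ((t - s : ℕ) : ℝ) * ℓ)) ≤
      if ((t - s : ℕ) : ℝ) < L / ℓ then B else 0 := by
    intro t _
    split_ifs with hlt
    · have h1 : ((t - s : ℕ) + 1 : ℝ) ≤ L / ℓ + 1 := by linarith
      have h2 : max 0 (L - ((t - s : ℕ) : ℝ) * ℓ) ≤ L := by
        refine max_le hL ?_
        have : 0 ≤ ((t - s : ℕ) : ℝ) * ℓ := by positivity
        linarith
      have h3 : ((t - s : ℕ) + 1 : ℝ) ^ 4 ≤ (L / ℓ + 1) ^ 4 := pow_le_pow_left₀ (by positivity) h1 4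
      calc ((t - s : ℕ) + 1 : ℝ) ^ 4 * (L ^ 2 * max 0 (L - ((t - s : ℕ) : ℝ) * ℓ))
          ≤ (L / ℓ + 1) ^ 4 * (L ^ 2 * L) :=
            mul_le_mul h3 (mul_le_mul_of_nonneg_left h2 (by positivity)) (by positivity) (by positivity)
        _ = B := by rw [hBdef]; ring
    · push Not at hlt
      have hle : L - ((t - s : ℕ) : ℝ) * ℓ ≤ 0 := by
        have := mul_le_mul_of_nonneg_right hlt hℓ.le
        rw [div_mul_cancel₀ L hℓ.ne'] at this
        linarith
      rw [max_eq_left hle]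
      simp
  refine (sum_le_sum hterm).trans ?_
  rw [sum_ite, sum_const_zero, add_zero, sum_const, nsmul_eq_mul]
  have hcard : (((S.filter fun t => ((t - s : ℕ) : ℝ) < L / ℓ).card : ℕ) : ℝ) ≤ L / ℓ + 1 := by
    have hsub : (S.filter fun t => ((t - s : ℕ) : ℝ) < L / ℓ) ⊆ Ico s (s + ⌈L / ℓ⌉₊) := by
      intro t ht
      rw [mem_filter] at ht
      rw [mem_Ico]
      have h1 := hS t ht.1
      have h2 : t - s < ⌈L / ℓ⌉₊ := Nat.lt_ceil.2 ht.2
      omega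
    calc (((S.filter fun t => ((t - s : ℕ) : ℝ) < L / ℓ).card : ℕ) : ℝ) ≤ ((Ico s (s + ⌈L / ℓ⌉₊)).card : ℝ) := by
          exact_mod_cast card_le_card hsub
      _ = ⌈L / ℓ⌉₊ := by rw [Nat.card_Ico, Nat.add_sub_cancel_left]
      _ ≤ L / ℓ + 1 := (Nat.ceil_lt_add_one (by positivity)).le
  calc (((S.filter fun t => ((t - s : ℕ) : ℝ) < L / ℓ).card : ℕ) : ℝ) * B ≤ (L / ℓ + 1) * B :=
        mul_le_mul_of_nonneg_right hcard hB
    _ = (L / ℓ + 1) ^ 5 * L ^ 3 := by rw [hBdef]; ring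

/-- **THE POLYLOG IS LINEAR.**  `(log k∕ℓ + 1)⁵ (log k)³ ≤ 8!·e·max(1, 1∕ℓ)⁸ · k` for every `k : ℕ`
(`(L+1)⁸ ≤ 8!·e^{L+1} = 8!·e·k`). [folklore] -/
theorem polylog_le {ℓ : ℝ} (hℓ : 0 < ℓ) (k : ℕ) :
    (Real.log k / ℓ + 1) ^ 5 * Real.log k ^ 3 ≤ 40320 * Real.exp 1 * max 1 (1 / ℓ) ^ 8 * k := by
  rcases Nat.eq_zero_or_pos k with hk | hk
  · subst hk
    simp
  · set L := Real.log k with hLdef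
    have hL : 0 ≤ L := Real.log_natCast_nonneg k
    set κ := max 1 (1 / ℓ) with hκdef
    have hκ1 : 1 ≤ κ := le_max_left _ _
    have hκ2 : 1 / ℓ ≤ κ := le_max_right _ _
    have h1 : L / ℓ + 1 ≤ κ * (L + 1) := by
      have e1 : L / ℓ = L * (1 / ℓ) := by ring
      rw [e1]
      nlinarith
    have h2 : L ≤ κ * (L + 1) := by nlinarith
    have h3 : (L / ℓ + 1) ^ 5 * L ^ 3 ≤ (κ * (L + 1)) ^ 8 := by
      calc (L / ℓ + 1) ^ 5 * L ^ 3 ≤ (κ * (L + 1)) ^ 5 * (κ * (L + 1)) ^ 3 :=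
            mul_le_mul (pow_le_pow_left₀ (by positivity) h1 5) (pow_le_pow_left₀ hL h2 3) (by positivity)
              (by positivity)
        _ = (κ * (L + 1)) ^ 8 := by ring
    have h4 : (L + 1) ^ 8 / (Nat.factorial 8) ≤ Real.exp (L + 1) :=
      Real.pow_div_factorial_le_exp (L + 1) (by positivity) 8
    have h5 : Real.exp (L + 1) = Real.exp 1 * k := by
      rw [Real.exp_add, hLdef, Real.exp_log (by exact_mod_cast hk)]
      ring
    have h8 : ((Nat.factorial 8 : ℕ) : ℝ) = 40320 := by norm_num [Nat.factorial]
    have h6 : (L + 1) ^ 8 ≤ 40320 * (Real.exp 1 * k) := by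
      rw [h8, div_le_iff₀ (by norm_num), h5] at h4
      linarith
    calc (L / ℓ + 1) ^ 5 * L ^ 3 ≤ (κ * (L + 1)) ^ 8 := h3
      _ = κ ^ 8 * (L + 1) ^ 8 := by ring
      _ ≤ κ ^ 8 * (40320 * (Real.exp 1 * k)) := mul_le_mul_of_nonneg_left h6 (by positivity)
      _ = 40320 * Real.exp 1 * max 1 (1 / ℓ) ^ 8 * k := by rw [hκdef]; ring

/-! ## §4 Assembly -/

/-- THE PER-EVENT CONSTANT of the crowding estimate (blows up as `σ ↑ 1` or `η ↓ 0`). [folklore] -/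
def crowdA (p σ η : ℝ) : ℝ :=
  p * (-Real.log (1 - σ)) + p ^ 3 / η ^ 2 * (40320 * Real.exp 1 * max 1 (1 / -Real.log σ) ^ 8)

/-- termwise form of the scale decomposition, valid also when `n_t = 0` [folklore] -/
theorem term_le {p σ : ℝ} (hp : 0 ≤ p) (h0 : 0 < σ) (h1 : σ < 1) (n : ℕ → ℕ) (t : ℕ) :
    p * n t * Real.log (Q n σ t) ≤
      p * n t * (-Real.log (1 - σ)) + ∑ s ∈ range (t + 1), p * n t * D n (-Real.log σ) s t := by
  rcases Nat.eq_zero_or_pos (n t) with ht | ht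
  · simp [ht]
  · rw [← mul_sum, ← mul_add]
    exact mul_le_mul_of_nonneg_left (log_Q_le h0 h1 n ht) (by positivity)

/-- the matched form of one `(s,t)` term, `j = t − s` [folklore] -/
theorem pair_le {p σ η : ℝ} (hp : 0 ≤ p) (h0 : 0 < σ) (h1 : σ < 1) (hη : 0 < η) (n : ℕ → ℕ) (s t : ℕ) :
    p * n t * D n (-Real.log σ) s t ≤
      η * (1 / ((t - s : ℕ) + 1 : ℝ) ^ 2) * (n t * Real.sqrt (n t)) +
        p ^ 3 / η ^ 2 * (((t - s : ℕ) + 1 : ℝ) ^ 4 *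
          (Real.log (n s) ^ 2 * max 0 (Real.log (n s) - ((t - s : ℕ) : ℝ) * (-Real.log σ)))) := by
  have hℓ : 0 < -Real.log σ := by linarith [Real.log_neg h0 h1]
  have hj : (0 : ℝ) < ((t - s : ℕ) + 1 : ℝ) := by positivity
  have hm := matching (p := p) (η := η * (1 / ((t - s : ℕ) + 1 : ℝ) ^ 2)) (N := (n t : ℝ)) (L := Real.log (n s))
    (d := D n (-Real.log σ) s t) hp (by positivity) (Nat.cast_nonneg _) (D_nonneg _ _ _ _) (D_le_log n hℓ.le s t)
  have he : p ^ 3 / (η * (1 / ((t - s : ℕ) + 1 : ℝ) ^ 2)) ^ 2 = p ^ 3 / η ^ 2 * ((t - s : ℕ) + 1 : ℝ) ^ 4 := by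
    field_simp
  rw [he] at hm
  unfold D at hm ⊢
  linarith [hm]

/-- **THE CROWDING ESTIMATE (sequence form).**  For `p ≥ 0`, `σ ∈ (0,1)`, `η > 0`, every `n : ℕ → ℕ` and `T`:
`Σ_{t ≤ T} p·n_t·log Q(t) ≤ 2η·Σ_{t ≤ T} n_t√n_t + crowdA p σ η · Σ_{t ≤ T} n_t`. [folklore] -/
theorem cost_le {p σ η : ℝ} (hp : 0 ≤ p) (h0 : 0 < σ) (h1 : σ < 1) (hη : 0 < η) (n : ℕ → ℕ) (T : ℕ) :
    ∑ t ∈ range (T + 1), p * n t * Real.log (Q n σ t) ≤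
      2 * η * ∑ t ∈ range (T + 1), (n t : ℝ) * Real.sqrt (n t) +
        crowdA p σ η * ∑ t ∈ range (T + 1), (n t : ℝ) := by
  set ℓ := -Real.log σ with hℓdef
  have hℓ : 0 < ℓ := by rw [hℓdef]; linarith [Real.log_neg h0 h1]
  set C := 40320 * Real.exp 1 * max 1 (1 / ℓ) ^ 8 with hCdef
  have hC : 0 ≤ C := by positivity
  -- the two summands of the matched terms
  set W : ℕ → ℕ → ℝ := fun s t => η * (1 / ((t - s : ℕ) + 1 : ℝ) ^ 2) * (n t * Real.sqrt (n t)) with hWdef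
  set E : ℕ → ℕ → ℝ := fun s t => p ^ 3 / η ^ 2 * (((t - s : ℕ) + 1 : ℝ) ^ 4 *
      (Real.log (n s) ^ 2 * max 0 (Real.log (n s) - ((t - s : ℕ) : ℝ) * ℓ))) with hEdef
  -- Step 1 + 2: termwise
  have step12 : ∑ t ∈ range (T + 1), p * n t * Real.log (Q n σ t) ≤
      ∑ t ∈ range (T + 1), (p * n t * (-Real.log (1 - σ)) + ∑ s ∈ range (t + 1), (W s t + E s t)) := by
    refine sum_le_sum fun t _ => (term_le hp h0 h1 n t).trans (add_le_add le_rfl (sum_le_sum fun s _ => ?_))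
    exact pair_le hp h0 h1 hη n s t
  -- the `W` part: `Σ_t Σ_{s ≤ t} W ≤ 2η Σ_t n_t √n_t`
  have stepW : ∑ t ∈ range (T + 1), ∑ s ∈ range (t + 1), W s t ≤
      2 * η * ∑ t ∈ range (T + 1), (n t : ℝ) * Real.sqrt (n t) := by
    rw [mul_sum]
    refine sum_le_sum fun t _ => ?_
    have hw : ∑ s ∈ range (t + 1), 1 / ((t - s : ℕ) + 1 : ℝ) ^ 2 ≤ 2 := by
      have hr := sum_range_reflect (fun j => 1 / ((j : ℝ) + 1) ^ 2) (t + 1)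
      simp only [Nat.add_sub_cancel] at hr
      rw [hr]
      have h2 := sum_inv_sq_le (m := t + 1) (Nat.succ_pos t)
      have h3 : 0 ≤ 1 / ((t + 1 : ℕ) : ℝ) := by positivity
      linarith
    have hnn : 0 ≤ (n t : ℝ) * Real.sqrt (n t) := by positivity
    calc ∑ s ∈ range (t + 1), W s t
        = η * (n t * Real.sqrt (n t)) * ∑ s ∈ range (t + 1), 1 / ((t - s : ℕ) + 1 : ℝ) ^ 2 := by
          rw [hWdef, mul_sum]
          exact sum_congr rfl fun s _ => by ring
      _ ≤ η * (n t * Real.sqrt (n t)) * 2 := mul_le_mul_of_nonneg_left hw (by positivity)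
      _ = 2 * η * ((n t : ℝ) * Real.sqrt (n t)) := by ring
  -- the `E` part: swap the sums, then per `s` the error sum and the polylog bound
  have stepE : ∑ t ∈ range (T + 1), ∑ s ∈ range (t + 1), E s t ≤
      p ^ 3 / η ^ 2 * C * ∑ s ∈ range (T + 1), (n s : ℝ) := by
    have hswap : ∑ t ∈ range (T + 1), ∑ s ∈ range (t + 1), E s t =
        ∑ s ∈ range (T + 1), ∑ t ∈ (range (T + 1)).filter (fun t => s ≤ t), E s t := by
      refine sum_comm' fun t s => ?_
      simp only [mem_range, mem_filter]
      omega
    rw [hswap, mul_sum]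
    refine sum_le_sum fun s _ => ?_
    have hL : 0 ≤ Real.log (n s) := Real.log_natCast_nonneg (n s)
    have hes := error_sum_le hL hℓ ((range (T + 1)).filter fun t => s ≤ t) s
      (fun t ht => (mem_filter.1 ht).2)
    have hpl := polylog_le hℓ (n s)
    calc ∑ t ∈ (range (T + 1)).filter (fun t => s ≤ t), E s t
        = p ^ 3 / η ^ 2 * ∑ t ∈ (range (T + 1)).filter (fun t => s ≤ t), ((t - s : ℕ) + 1 : ℝ) ^ 4 *
            (Real.log (n s) ^ 2 * max 0 (Real.log (n s) - ((t - s : ℕ) : ℝ) * ℓ)) := by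
          rw [hEdef, mul_sum]
      _ ≤ p ^ 3 / η ^ 2 * ((Real.log (n s) / ℓ + 1) ^ 5 * Real.log (n s) ^ 3) :=
          mul_le_mul_of_nonneg_left hes (by positivity)
      _ ≤ p ^ 3 / η ^ 2 * (C * n s) := mul_le_mul_of_nonneg_left (by rw [hCdef]; linarith [hpl]) (by positivity)
      _ = p ^ 3 / η ^ 2 * C * (n s : ℝ) := by ring
  -- assemble
  have hsplit : ∑ t ∈ range (T + 1), (p * n t * (-Real.log (1 - σ)) + ∑ s ∈ range (t + 1), (W s t + E s t)) =
      p * (-Real.log (1 - σ)) * ∑ t ∈ range (T + 1), (n t : ℝ) +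
        (∑ t ∈ range (T + 1), ∑ s ∈ range (t + 1), W s t + ∑ t ∈ range (T + 1), ∑ s ∈ range (t + 1), E s t) := by
    rw [mul_sum, ← sum_add_distrib, ← sum_add_distrib]
    exact sum_congr rfl fun t _ => by rw [sum_add_distrib]; ring
  have hA : crowdA p σ η = p * (-Real.log (1 - σ)) + p ^ 3 / η ^ 2 * C := by
    rw [crowdA, hCdef, hℓdef]
  rw [hA, add_mul]
  linarith [step12, stepW, stepE, hsplit]

/-! ## §5 Sanity (closed instances; not used elsewhere) -/

namespace Sanity

/-- the discounted crowding of the empty history is `0` -/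
theorem Q_zero (σ : ℝ) (t : ℕ) : Q (fun _ => 0) σ t = 0 := by simp [Q]

/-- `1 + 1∕4 + 1∕9 ≤ 2 − 1∕3` -/
theorem inv_sq_three : ∑ j ∈ range 3, 1 / ((j : ℝ) + 1) ^ 2 ≤ 2 - 1 / ((3 : ℕ) : ℝ) :=
  sum_inv_sq_le (by norm_num)

end Sanity

end

end Summit.QuantumFields.BalabanUV.T4Continuum.Crowding
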